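import Mathlib
import Literature.Computability.AlgebraicComplexity.OrbitClosureWeights

/-!
# The universal form of `ℂ[Sym^m ℂ^σ]` and the `GL_σ`-action read on it (crux `ValuativeGCT.ValuativeFlip`,
# stmt-ValiantsHypothesis-12624; wall-breaker axis k13 "explicit padded-permanent highest-weight
# vectors for seedRichness" — the bridge for `r`-letter explicit semi-invariants)

For ANY finite set of letters `σ` (not only two), the coordinate ring
`ℂ[Sym^m ℂ^σ] = MvPolynomial (DegIdx σ m) ℂ` carries the universal form
`𝔲 = ∑_{|d| = m} X_d · x^d ∈ ℂ[Sym^m ℂ^σ][x_σ]` (`universalForm σ m`), homogeneous of degree `m`, which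
specialises to `g` under `X_d ↦ coeff_d g` (`map_aeval_formCoeff_universalForm`).  The action
`coordRep`/`coordSubst m b` of `b ∈ GL_σ` on the coefficients of `𝔲` is the linear substitution of `𝔲` by
the constant matrix `b⁻¹` (`map_coordSubst_universalForm`:
`∑_d (b · X_d) x^d = ∑_e X_e (b⁻¹ · x^e)`).  Consequently a polynomial construction `Φ(h)` on `σ`-ary
forms `h` over arbitrary commutative `ℂ`-algebras that is natural in the base and satisfies
`Φ(h ∘ c) = θ(c) Φ(h)` for upper triangular `c` yields the highest-weight vector `Φ(𝔲) ∈ ℂ[Sym^m ℂ^σ]`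
of `coordRep` (`coordSubst m b (Φ 𝔲) = Φ (map (coordSubst m b) 𝔲) = Φ (𝔲 ∘ b⁻¹) = θ(b⁻¹) Φ(𝔲)`) — the
mechanism used for the binary protomorphs (`…ProtoHwv.lean`, `σ = Fin 2`,
`protoHWV_mem_highestWeightSpace`) and the entry point for explicit `r`-letter semi-invariants
(iterated Tschirnhaus normal forms, AXIS.md of the seat).

Sources: folklore; Mulmuley–Sohoni 2001 §4 (the action on `k[V]`), BLMW 2011 (5.2.2).
-/

set_option linter.dupNamespace false

namespace Summit.ValiantsHypothesis.ValiantsHypothesis.Theorems.ValuativeFlip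

open MvPolynomial
open scoped BigOperators
open Literature.NumberTheory.DiophantineGeometry Literature.Computability.AlgebraicComplexity

noncomputable section

section UniversalForm

variable (σ : Type*) [Fintype σ] [LinearOrder σ] (m : ℕ)

/-- **The universal `σ`-ary form of degree `m`**: `𝔲 = ∑_{|d| = m} X_d · x^d`, with coefficients in the
coordinate ring `ℂ[Sym^m ℂ^σ]`. [folklore] -/
def universalForm : MvPolynomial σ (MvPolynomial (DegIdx σ m) ℂ) :=
  ∑ d : DegIdx σ m, C (X d) * monomial d.1 1

/-- The universal form is homogeneous of degree `m`. [folklore] -/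
theorem isHomogeneous_universalForm : (universalForm σ m).IsHomogeneous m := by
  rw [universalForm]
  refine IsHomogeneous.sum _ _ _ fun d _ => ?_
  have h := (isHomogeneous_C σ (X d : MvPolynomial (DegIdx σ m) ℂ)).mul
    (isHomogeneous_monomial (R := MvPolynomial (DegIdx σ m) ℂ) (1 : MvPolynomial (DegIdx σ m) ℂ)
      (mem_degMonomials_iff.mp d.2))
  rwa [zero_add] at h

variable {σ m}

/-- Base change of the universal form along a ring homomorphism. [folklore] -/
theorem map_universalForm {S : Type*} [CommSemiring S] (ψ : MvPolynomial (DegIdx σ m) ℂ →+* S) :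
    map ψ (universalForm σ m) = ∑ d : DegIdx σ m, C (ψ (X d)) * monomial d.1 1 := by
  rw [universalForm, map_sum]
  refine Finset.sum_congr rfl fun d _ => ?_
  rw [map_mul, map_C, map_monomial, map_one]

/-- **Specialisation**: under `X_d ↦ coeff_d g` the universal form becomes the form `g` of degree `m`.
[folklore] -/
theorem map_aeval_formCoeff_universalForm {g : MvPolynomial σ ℂ} (hg : g.IsHomogeneous m) :
    map (aeval (formCoeff m g) : MvPolynomial (DegIdx σ m) ℂ →ₐ[ℂ] ℂ).toRingHom (universalForm σ m) = g := by
  classical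
  rw [map_universalForm]
  conv_rhs => rw [← sum_coeff_smul_monomial_eq hg]
  refine Finset.sum_congr rfl fun d _ => ?_
  rw [AlgHom.toRingHom_eq_coe, RingHom.coe_coe, aeval_X, formCoeff_apply, smul_eq_C_mul]

omit [LinearOrder σ] in
/-- Naturality of `linSubst` under base change (any letters). [folklore] -/
theorem map_linSubst_of_ringHom {S T : Type*} [CommRing S] [CommRing T] (f : S →+* T)
    (A : Matrix σ σ S) (p : MvPolynomial σ S) :
    map f (linSubst σ S A p) = linSubst σ T (A.map f) (map f p) := by
  induction p using MvPolynomial.induction_on with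
  | C a => rw [linSubst_C, map_C, linSubst_C]
  | add p q hp hq => rw [map_add, map_add, map_add, hp, hq, map_add]
  | mul_X p i hp =>
    rw [map_mul, map_mul, map_mul, hp, map_X, map_mul, linSubst_X, linSubst_X, map_sum]
    congr 1
    refine Finset.sum_congr rfl fun j _ => ?_
    rw [smul_eq_C_mul, smul_eq_C_mul, map_mul, map_C, map_X, Matrix.map_apply]

/-- **The `GL_σ`-action on `ℂ[Sym^m ℂ^σ]` read on the universal form**: applying `b · (-) = coordSubst m b`
to the coefficients of `𝔲` is the linear substitution of `𝔲` by the constant matrix `b⁻¹`: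
`∑_d (b · X_d) x^d = ∑_e X_e · (b⁻¹ · x^e)`. [folklore] -/
theorem map_coordSubst_universalForm (b : GL σ ℂ) :
    map (coordSubst m b).toRingHom (universalForm σ m) =
      linSubst σ (MvPolynomial (DegIdx σ m) ℂ)
        (((b⁻¹ : GL σ ℂ) : Matrix σ σ ℂ).map C) (universalForm σ m) := by
  classical
  have hR : linSubst σ (MvPolynomial (DegIdx σ m) ℂ) (((b⁻¹ : GL σ ℂ) : Matrix σ σ ℂ).map C)
      (universalForm σ m) = ∑ e : DegIdx σ m, C (X e) * ∑ d : DegIdx σ m,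
        C (C (coeff d.1 (linSubstRep σ ℂ b⁻¹ (monomial e.1 1)))) * monomial d.1 1 := by
    rw [universalForm, map_sum]
    refine Finset.sum_congr rfl fun e _ => ?_
    rw [map_mul, ← algebraMap_eq (R := MvPolynomial (DegIdx σ m) ℂ), AlgHom.commutes, algebraMap_eq]
    congr 1
    have hmon : (monomial e.1 (1 : MvPolynomial (DegIdx σ m) ℂ) : MvPolynomial σ (MvPolynomial (DegIdx σ m) ℂ)) =
        map (C : ℂ →+* MvPolynomial (DegIdx σ m) ℂ) (monomial e.1 (1 : ℂ)) := by
      rw [map_monomial, C_1]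
    rw [hmon, ← map_linSubst_of_ringHom, linSubstRep_apply]
    conv_lhs => rw [← sum_coeff_smul_monomial_eq (linSubst_isHomogeneous _
      (isHomogeneous_monomial (R := ℂ) (1 : ℂ) (mem_degMonomials_iff.mp e.2)))]
    rw [map_sum]
    refine Finset.sum_congr rfl fun d _ => ?_
    rw [smul_eq_C_mul, map_mul, map_C, map_monomial, C_1]
  rw [hR, map_universalForm]
  simp only [AlgHom.toRingHom_eq_coe, RingHom.coe_coe, coordSubst_X, map_sum, Finset.sum_mul,
    Finset.mul_sum]
  rw [Finset.sum_comm]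
  refine Finset.sum_congr rfl fun e _ => Finset.sum_congr rfl fun d _ => ?_
  rw [smul_eq_C_mul, map_mul]
  ring

end UniversalForm

end

end Summit.ValiantsHypothesis.ValiantsHypothesis.Theorems.ValuativeFlip
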